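import Literature.NumberTheory.GaloisCohomology.Howard2004.DVRKolyvaginBound
import Literature.NumberTheory.GaloisCohomology.Howard2004.PrincipalArtinianDivisibilityProofs
import Mathlib.NumberTheory.Padics.RingHoms
import HarnessLib

/-!
# Howard 2004, §1.6 with Rem. 1.3.1: the level rings `R/π^j R` of the `π`-adic refinement of a
# `DVRSetting`, and H.0 on the refined levels (definitions with bodies + theorems)

B. Howard, *The Heegner point Kolyvagin system*, Compositio Math. **140** (2004) (arXiv:1202.6340), proof of
Thm. 1.6.1 (arXiv p. 11 L33–38): «`R^{(k)} = R/𝔪^k` … the Selmer triple `(T^{(k)}, F, 𝓛^{(k)})` satisfies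
hypotheses H.0–H.5» (Rem. 1.3.1: «H.0–H.5 are stable under base change»).  Brick (R2a) of the refinement
constructor (REFINE, cell `pub/bsd-print-x9`; R1 = `DVRSettingPiRefinement`): the LEVEL RINGS of the refined
setting and what the other bricks consume of them.

* §1 (private) `padicInt_ringHom_eq_of_pow_eq_zero` — a ring homomorphism out of `ℤ_[p]` into a ring in which
  `p^n = 0` is unique ([folklore]; `PadicInt.appr`).  WHY: `DVRSetting` binds an ARBITRARY `Algebra ℤ_[p] (Rk k)`
  on the level rings (no `IsScalarTower ℤ_[p] R (Rk k)`); it is nevertheless the one through `R`, because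
  `p^{e_k} = 0` in `R_k` (§3 `toQuotRing_algebraMap_padicInt`, consumed by the duality data of the refinement).
* §2 **`DVRSetting.QuotRing S j := R ⧸ (π^j)`** (an `abbrev`: `CommRing`, `Algebra R`, `Algebra ℤ_[p]` and
  `Module (S.QuotRing j) (M ⧸ (π^j) • M)` are Mathlib instances), its discrete topology `quotRingTopology := ⊥`
  (a reducible def to be bound with `letI`, as the Eisenstein frames bind their level-ring data; no `instance`),
  `isLocalRing_quotRing`, `maximalIdeal_quotRing`, `natCast_p_mem_maximalIdeal` (`p ∈ 𝔪`, coefficient ring).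
* §3 **`DVRSetting.toQuotRing S hy (h : j ≤ S.e k) : Rk k →+* S.QuotRing j`** — the reduction
  `R_k = R/𝔪^{e_k} ↠ R/π^j` (`RingHom.liftOfSurjective` along `algebraMap R (Rk k)`), `toQuotRing_algebraMap`,
  `toQuotRing_surjective`, `toQuotRing_redR`, `factor_toQuotRing`, `toQuotRing_algebraMap_padicInt`.
* §4 **H.0 on the refined levels**: for `1 ≤ j ≤ e_k`, `T^{(k)}/π^j T^{(k)}` is free of rank two over `R/π^j`
  (`basisQuotLevel`, `h0_quotLevel`) — with `k = host j` this is literally `H0 (S.QuotRing j) (D.Level j)` for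
  `D = S.piRefinementDatum hy`.

Definitions with bodies and theorems only: no named fact, no instance, no notation, no `sorry`.
`thm161_dvrKolyvaginBound` is NOT proved here; BSD is not proved by any of this.
-/

set_option autoImplicit false

noncomputable section

open Function NumberField IsDedekindDomain Field
open scoped NumberField Classical

namespace Literature.NumberTheory.GaloisCohomology.Howard2004

open Literature.NumberTheory.GaloisRepresentations
open Literature.NumberTheory.GaloisRepresentations.DiscreteGaloisModule

/-! ## §1 Ring homomorphisms out of `ℤ_[p]` into `p`-nilpotent rings are unique -/

/-- **A ring homomorphism `ℤ_[p] → A` is determined when `p^n = 0` in `A`**: every `x ∈ ℤ_[p]` is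
`appr x n + p^n y`, so `f x = appr x n` (private helper; the public, cited consequences are
`algebraMap_padicInt_levelRing` and `toQuotRing_algebraMap_padicInt`). [folklore] -/
private theorem padicInt_ringHom_eq_of_pow_eq_zero {p : ℕ} [Fact p.Prime] {A : Type*} [Semiring A]
    (f g : ℤ_[p] →+* A) {n : ℕ} (hn : (p : A) ^ n = 0) : f = g := by
  ext x
  obtain ⟨y, hy⟩ := Ideal.mem_span_singleton'.mp (PadicInt.appr_spec n x)
  have hx : x = (PadicInt.appr x n : ℤ_[p]) + y * (p : ℤ_[p]) ^ n := by rw [hy, add_sub_cancel]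
  rw [hx, map_add, map_add, map_natCast, map_natCast, map_mul, map_mul, map_pow, map_pow, map_natCast,
    map_natCast, hn, mul_zero, mul_zero]

namespace DVRSetting

variable {p : ℕ} [Fact p.Prime] {K : Type} [Field K] [NumberField K]
  {R : Type} [CommRing R] [IsDomain R] [IsDiscreteValuationRing R] [Algebra ℤ_[p] R]
  {N : ℕ → Type} [∀ k, AddCommGroup (N k)] [∀ k, TopologicalSpace (N k)]
  [∀ k, DiscreteTopology (N k)] [∀ k, Module R (N k)]
  {Rk : ℕ → Type} [∀ k, CommRing (Rk k)] [∀ k, IsLocalRing (Rk k)] [∀ k, TopologicalSpace (Rk k)]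
  [∀ k, DiscreteTopology (Rk k)] [∀ k, Algebra ℤ_[p] (Rk k)] [∀ k, Algebra R (Rk k)]
  [∀ k, Module (Rk k) (N k)] [∀ k, IsScalarTower R (Rk k) (N k)]
  {Nbar : Type} [AddCommGroup Nbar] [TopologicalSpace Nbar] [DiscreteTopology Nbar]
  [∀ k, Module (Rk k) Nbar]
  {Nq : ℕ → Finset (HeightOneSpectrum (𝓞 K)) → Type} [∀ k n, AddCommGroup (Nq k n)]
  [∀ k n, TopologicalSpace (Nq k n)] [∀ k n, DiscreteTopology (Nq k n)]
  [∀ k n, Module (Rk k) (Nq k n)] [∀ k n, Module R (Nq k n)]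
  [∀ k n, IsScalarTower R (Rk k) (Nq k n)]

/-! ## §2 The level rings `R/π^j` of the refinement -/

/-- **The level ring `R/π^jR` of exponent `j`** of the `π`-adic refinement (Howard's `R^{(j)} = R/𝔪^j`);
an `abbrev` of the quotient ring, so that `CommRing`, `Algebra R`, `Algebra ℤ_[p]` and the module structure
on `M ⧸ (π^j)•M` are Mathlib's instances. [cite: Howard2004HeegnerKolyvagin, §1.6 (arXiv p. 11, L33–34)] -/
abbrev QuotRing (S : DVRSetting p K R N Rk Nbar Nq) (j : ℕ) : Type := R ⧸ Ideal.span {S.π ^ j}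

/-- The (discrete) topology of the level ring `R/π^j` — a reducible definition to be bound with `letI`
(the setting's level rings carry `TopologicalSpace`/`DiscreteTopology` as parameters; no instance is
declared). [cite: Howard2004HeegnerKolyvagin, §1.6 (arXiv p. 11, L33–34)] -/
@[reducible] def quotRingTopology (S : DVRSetting p K R N Rk Nbar Nq) (j : ℕ) : TopologicalSpace (S.QuotRing j) := ⊥

/-- The topology `quotRingTopology` is discrete. [cite: Howard2004HeegnerKolyvagin, §1.6 (arXiv p. 11, L33–34)] -/
theorem quotRing_discreteTopology (S : DVRSetting p K R N Rk Nbar Nq) (j : ℕ) :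
    @DiscreteTopology (S.QuotRing j) (S.quotRingTopology j) :=
  @DiscreteTopology.mk _ (S.quotRingTopology j) rfl

/-- `π^j` is not a unit for `j ≥ 1`, so `(π^j) ≠ R`. [cite: Howard2004HeegnerKolyvagin, §1.6 (arXiv p. 11, L13–14)] -/
theorem span_pi_pow_ne_top (S : DVRSetting p K R N Rk Nbar Nq) (hy : S.SatisfiesH) {j : ℕ} (hj : 1 ≤ j) :
    Ideal.span {S.π ^ j} ≠ ⊤ := by
  intro h
  rw [Ideal.span_singleton_eq_top] at h
  have hπ : S.π ∈ IsLocalRing.maximalIdeal R := by rw [hy.unif]; exact Ideal.mem_span_singleton_self _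
  exact (IsLocalRing.mem_maximalIdeal _).mp hπ (isUnit_of_dvd_unit (dvd_pow_self S.π (by omega)) h)

/-- `R/π^j` is non-trivial for `j ≥ 1`. [cite: Howard2004HeegnerKolyvagin, §1.6 (arXiv p. 11, L33–34)] -/
theorem nontrivial_quotRing (S : DVRSetting p K R N Rk Nbar Nq) (hy : S.SatisfiesH) {j : ℕ} (hj : 1 ≤ j) :
    Nontrivial (S.QuotRing j) :=
  Ideal.Quotient.nontrivial_iff.mpr (S.span_pi_pow_ne_top hy hj)

/-- **`R/π^j` is a local ring** (`j ≥ 1`) — to be bound with `haveI`. [cite: Howard2004HeegnerKolyvagin, §1.6 (arXiv p. 11, L33–34)] -/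
theorem isLocalRing_quotRing (S : DVRSetting p K R N Rk Nbar Nq) (hy : S.SatisfiesH) {j : ℕ} (hj : 1 ≤ j) :
    IsLocalRing (S.QuotRing j) :=
  haveI := S.nontrivial_quotRing hy hj
  IsLocalRing.of_surjective' (Ideal.Quotient.mk _) Ideal.Quotient.mk_surjective

/-- The maximal ideal of `R/π^j` is generated by the class of `π`. [cite: Howard2004HeegnerKolyvagin, §1.6 (arXiv p. 11, L33–34)] -/
theorem maximalIdeal_quotRing (S : DVRSetting p K R N Rk Nbar Nq) (hy : S.SatisfiesH) {j : ℕ} (hj : 1 ≤ j) :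
    haveI := S.isLocalRing_quotRing hy hj
    IsLocalRing.maximalIdeal (S.QuotRing j) = Ideal.span {Ideal.Quotient.mk _ S.π} := by
  haveI := S.isLocalRing_quotRing hy hj
  rw [← IsLocalRing.map_maximalIdeal_of_surjective (Ideal.Quotient.mk (Ideal.span {S.π ^ j}))
    Ideal.Quotient.mk_surjective, hy.unif, Ideal.map_span, Set.image_singleton]

/-- `R/π^j` is principal Artinian of length `j` (`𝔪 = (π̄)`, `π̄^j = 0`, `π̄^{j-1} ≠ 0`).
[cite: Howard2004HeegnerKolyvagin, Rem. 1.1.4 and §1.6 (arXiv p. 5 L100–105, p. 11 L33–34)] -/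
theorem isPrincipalArtinianOfLength_quotRing (S : DVRSetting p K R N Rk Nbar Nq) (hy : S.SatisfiesH) {j : ℕ}
    (hj : 1 ≤ j) :
    haveI := S.isLocalRing_quotRing hy hj
    IsPrincipalArtinianOfLength (S.QuotRing j) j := by
  haveI := S.isLocalRing_quotRing hy hj
  have hπ : Irreducible S.π := (IsDiscreteValuationRing.irreducible_iff_uniformizer S.π).mpr hy.unif
  refine ⟨⟨Ideal.Quotient.mk _ S.π, by rw [S.maximalIdeal_quotRing hy hj, Ideal.submodule_span_eq]⟩, ?_, ?_⟩
  · rw [S.maximalIdeal_quotRing hy hj, Ideal.span_singleton_pow, Ideal.span_singleton_eq_bot, ← map_pow,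
      Ideal.Quotient.eq_zero_iff_mem]
    exact Ideal.mem_span_singleton_self _
  · intro _
    rw [S.maximalIdeal_quotRing hy hj, Ideal.span_singleton_pow, Ne, Ideal.span_singleton_eq_bot, ← map_pow,
      Ideal.Quotient.eq_zero_iff_mem, Ideal.mem_span_singleton]
    intro h
    have := (pow_dvd_pow_iff (IsDiscreteValuationRing.not_a_field R ∘ fun h0 => by
      rw [hy.unif, Ideal.span_singleton_eq_bot]; exact h0) hπ.not_isUnit).mp h
    omega

/-- **`p ∈ 𝔪`**: the residue field of the coefficient ring `R` has characteristic `p`.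
[cite: Howard2004HeegnerKolyvagin, §1 conventions (arXiv p. 4, L47–52)] -/
theorem natCast_p_mem_maximalIdeal (S : DVRSetting p K R N Rk Nbar Nq) (hy : S.SatisfiesH) :
    ((p : ℕ) : R) ∈ IsLocalRing.maximalIdeal R := by
  haveI := hy.coeffRing.charP_residueField
  rw [← IsLocalRing.residue_eq_zero_iff, map_natCast]
  exact CharP.cast_eq_zero _ p

/-- `p = π · a` for some `a ∈ R`. [cite: Howard2004HeegnerKolyvagin, §1 conventions and §1.6 (arXiv p. 4 L47–52, p. 11 L13–14)] -/
theorem exists_natCast_p_eq_pi_mul (S : DVRSetting p K R N Rk Nbar Nq) (hy : S.SatisfiesH) :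
    ∃ a : R, ((p : ℕ) : R) = S.π * a := by
  have h := S.natCast_p_mem_maximalIdeal hy
  rw [hy.unif, Ideal.mem_span_singleton'] at h
  obtain ⟨a, ha⟩ := h
  exact ⟨a, by rw [← ha, mul_comm]⟩

/-- `p^j = 0` in `R/π^j`. [cite: Howard2004HeegnerKolyvagin, §1.6 (arXiv p. 11, L33–34)] -/
theorem natCast_p_pow_quotRing (S : DVRSetting p K R N Rk Nbar Nq) (hy : S.SatisfiesH) (j : ℕ) :
    ((p : ℕ) : S.QuotRing j) ^ j = 0 := by
  obtain ⟨a, ha⟩ := S.exists_natCast_p_eq_pi_mul hy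
  rw [← map_natCast (Ideal.Quotient.mk (Ideal.span {S.π ^ j})), ← map_pow, Ideal.Quotient.eq_zero_iff_mem, ha,
    mul_pow]
  exact Ideal.mul_mem_right _ _ (Ideal.mem_span_singleton_self _)

/-- `p^{e_k} = 0` in the level ring `R_k = R/𝔪^{e_k}`. [cite: Howard2004HeegnerKolyvagin, §1.6 (arXiv p. 11, L33–34)] -/
theorem natCast_p_pow_levelRing (S : DVRSetting p K R N Rk Nbar Nq) (hy : S.SatisfiesH) (k : ℕ) :
    ((p : ℕ) : Rk k) ^ S.e k = 0 := by
  rw [← map_natCast (algebraMap R (Rk k)), ← map_pow, ← RingHom.mem_ker, hy.ker_algebraMap]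
  exact Ideal.pow_mem_pow (S.natCast_p_mem_maximalIdeal hy) _

/-- **The `ℤ_[p]`-algebra structure of a level ring is the one through `R`** (rigidity §1 + `p^{e_k} = 0`).
[cite: Howard2004HeegnerKolyvagin, §1.6 (arXiv p. 11, L33–34)] -/
theorem algebraMap_padicInt_levelRing (S : DVRSetting p K R N Rk Nbar Nq) (hy : S.SatisfiesH) (k : ℕ)
    (z : ℤ_[p]) : algebraMap ℤ_[p] (Rk k) z = algebraMap R (Rk k) (algebraMap ℤ_[p] R z) := by
  have h := padicInt_ringHom_eq_of_pow_eq_zero (algebraMap ℤ_[p] (Rk k))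
    ((algebraMap R (Rk k)).comp (algebraMap ℤ_[p] R)) (S.natCast_p_pow_levelRing hy k)
  exact congrArg (fun φ => φ z) h

/-! ## §3 The reductions `R_k ↠ R/π^j` -/

/-- `ker (R → R_k) = 𝔪^{e_k} ≤ (π^j)` for `j ≤ e_k`. [cite: Howard2004HeegnerKolyvagin, §1.6 (arXiv p. 11, L33–34)] -/
theorem ker_algebraMap_le_span_pow (S : DVRSetting p K R N Rk Nbar Nq) (hy : S.SatisfiesH) {j k : ℕ}
    (h : j ≤ S.e k) : RingHom.ker (algebraMap R (Rk k)) ≤ Ideal.span {S.π ^ j} := by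
  rw [hy.ker_algebraMap, hy.unif, Ideal.span_singleton_pow]
  exact Ideal.span_singleton_le_span_singleton.mpr (pow_dvd_pow _ h)

/-- **The reduction `R_k = R/𝔪^{e_k} ↠ R/π^j`** for `j ≤ e_k` (the lift of `R ↠ R/π^j` along the onto map
`R ↠ R_k`). [cite: Howard2004HeegnerKolyvagin, §1.6 (arXiv p. 11, L33–34)] -/
def toQuotRing (S : DVRSetting p K R N Rk Nbar Nq) (hy : S.SatisfiesH) {j k : ℕ} (h : j ≤ S.e k) :
    Rk k →+* S.QuotRing j :=
  (algebraMap R (Rk k)).liftOfSurjective (hy.algebraMap_surjective k)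
    ⟨Ideal.Quotient.mk _, (S.ker_algebraMap_le_span_pow hy h).trans_eq Ideal.mk_ker.symm⟩

/-- `toQuotRing ∘ (R → R_k) = (R → R/π^j)`. [cite: Howard2004HeegnerKolyvagin, §1.6 (arXiv p. 11, L33–34)] -/
@[simp] theorem toQuotRing_algebraMap (S : DVRSetting p K R N Rk Nbar Nq) (hy : S.SatisfiesH) {j k : ℕ}
    (h : j ≤ S.e k) (r : R) : S.toQuotRing hy h (algebraMap R (Rk k) r) = Ideal.Quotient.mk _ r :=
  (algebraMap R (Rk k)).liftOfSurjective_comp_apply (hy.algebraMap_surjective k) _ r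

/-- `toQuotRing` is onto. [cite: Howard2004HeegnerKolyvagin, §1.6 (arXiv p. 11, L33–34)] -/
theorem toQuotRing_surjective (S : DVRSetting p K R N Rk Nbar Nq) (hy : S.SatisfiesH) {j k : ℕ}
    (h : j ≤ S.e k) : Surjective (S.toQuotRing hy h) := by
  intro x
  obtain ⟨r, rfl⟩ := Ideal.Quotient.mk_surjective x
  exact ⟨algebraMap R (Rk k) r, S.toQuotRing_algebraMap hy h r⟩

/-- `ker toQuotRing = (π̄^j)`, `π̄ = algebraMap R R_k π`. [cite: Howard2004HeegnerKolyvagin, §1.6 (arXiv p. 11, L33–34)] -/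
theorem ker_toQuotRing (S : DVRSetting p K R N Rk Nbar Nq) (hy : S.SatisfiesH) {j k : ℕ} (h : j ≤ S.e k) :
    RingHom.ker (S.toQuotRing hy h) = Ideal.span {algebraMap R (Rk k) S.π ^ j} := by
  ext x
  obtain ⟨r, rfl⟩ := hy.algebraMap_surjective k x
  have hmap : Ideal.span {algebraMap R (Rk k) S.π ^ j} = (Ideal.span {S.π ^ j}).map (algebraMap R (Rk k)) := by
    rw [Ideal.map_span, Set.image_singleton, map_pow]
  rw [RingHom.mem_ker, toQuotRing_algebraMap, Ideal.Quotient.eq_zero_iff_mem, hmap,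
    Ideal.mem_map_iff_of_surjective _ (hy.algebraMap_surjective k)]
  constructor
  · exact fun hr => ⟨r, hr, rfl⟩
  · rintro ⟨s, hs, hsr⟩
    have hker : r - s ∈ RingHom.ker (algebraMap R (Rk k)) := by rw [RingHom.mem_ker, map_sub, hsr, sub_self]
    rw [← sub_add_cancel r s]
    exact Ideal.add_mem _ (S.ker_algebraMap_le_span_pow hy h hker) hs

/-- Compatibility with the reductions `R_{k+1} → R_k` of the setting. [cite: Howard2004HeegnerKolyvagin, §1.6 (arXiv p. 11, L33–34)] -/
theorem toQuotRing_redR (S : DVRSetting p K R N Rk Nbar Nq) (hy : S.SatisfiesH) {j k : ℕ} (h : j ≤ S.e k)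
    (h' : j ≤ S.e (k + 1)) (x : Rk (k + 1)) : S.toQuotRing hy h (S.redR k x) = S.toQuotRing hy h' x := by
  obtain ⟨r, rfl⟩ := hy.algebraMap_surjective (k + 1) x
  rw [hy.redR_comp, toQuotRing_algebraMap, toQuotRing_algebraMap]

/-- Independence of the level: the reductions from two levels `k ≤ k'` agree along any map commuting with
the structure maps (used with the iterated `redR`). [cite: Howard2004HeegnerKolyvagin, §1.6 (arXiv p. 11, L33–34)] -/
theorem toQuotRing_comp_eq (S : DVRSetting p K R N Rk Nbar Nq) (hy : S.SatisfiesH) {j k k' : ℕ}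
    (h : j ≤ S.e k) (h' : j ≤ S.e k') (φ : Rk k' →+* Rk k)
    (hφ : ∀ r : R, φ (algebraMap R (Rk k') r) = algebraMap R (Rk k) r) (x : Rk k') :
    S.toQuotRing hy h (φ x) = S.toQuotRing hy h' x := by
  obtain ⟨r, rfl⟩ := hy.algebraMap_surjective k' x
  rw [hφ, toQuotRing_algebraMap, toQuotRing_algebraMap]

/-- Compatibility between exponents `j ≤ j'`: `R/π^{j'} ↠ R/π^j` after `toQuotRing` is `toQuotRing`.
[cite: Howard2004HeegnerKolyvagin, §1.6 (arXiv p. 11, L33–34)] -/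
theorem factor_toQuotRing (S : DVRSetting p K R N Rk Nbar Nq) (hy : S.SatisfiesH) {j j' k : ℕ} (hjj' : j ≤ j')
    (h' : j' ≤ S.e k) (x : Rk k) :
    Ideal.Quotient.factor (Ideal.span_singleton_le_span_singleton.mpr (pow_dvd_pow S.π hjj'))
        (S.toQuotRing hy h' x) = S.toQuotRing hy (hjj'.trans h') x := by
  obtain ⟨r, rfl⟩ := hy.algebraMap_surjective k x
  rw [toQuotRing_algebraMap, toQuotRing_algebraMap, Ideal.Quotient.factor_mk]

/-- **`toQuotRing` respects the `ℤ_[p]`-algebra structures** (the level ring's arbitrary one and `R/π^j`'s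
through `R`): both sides are ring homomorphisms `ℤ_[p] → R/π^j` and `p^j = 0` there (§1).
[cite: Howard2004HeegnerKolyvagin, §1.6 (arXiv p. 11, L33–34)] -/
theorem toQuotRing_algebraMap_padicInt (S : DVRSetting p K R N Rk Nbar Nq) (hy : S.SatisfiesH) {j k : ℕ}
    (h : j ≤ S.e k) (z : ℤ_[p]) :
    S.toQuotRing hy h (algebraMap ℤ_[p] (Rk k) z) = algebraMap ℤ_[p] (S.QuotRing j) z := by
  have hfg := padicInt_ringHom_eq_of_pow_eq_zero ((S.toQuotRing hy h).comp (algebraMap ℤ_[p] (Rk k)))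
    (algebraMap ℤ_[p] (S.QuotRing j)) (S.natCast_p_pow_quotRing hy j)
  exact congrArg (fun φ => φ z) hfg

/-! ## §4 H.0 on the refined levels: `T^{(k)}/π^j T^{(k)}` is free of rank two over `R/π^j` -/

/-- The submodule `π^j T^{(k)}` over `R` is `π̄^j T^{(k)}` over `R_k`. [cite: Howard2004HeegnerKolyvagin, Def. 1.1.3 (arXiv p. 5, L93–99)] -/
theorem mem_span_pi_pow_smul_top_iff (S : DVRSetting p K R N Rk Nbar Nq) (k j : ℕ) (x : N k) :
    x ∈ Ideal.span {S.π ^ j} • (⊤ : Submodule R (N k)) ↔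
      x ∈ Ideal.span {algebraMap R (Rk k) S.π ^ j} • (⊤ : Submodule (Rk k) (N k)) := by
  rw [← map_pow]
  exact mem_span_singleton_smul_top_iff_of_isScalarTower (A := Rk k) (S.π ^ j) x

/-- Coordinates detect `π^j T^{(k)}`: `x ∈ π^j T^{(k)} ↔` every coordinate of `x` in an `R_k`-basis lies in
`(π̄^j)`. [cite: Howard2004HeegnerKolyvagin, H.0 and Def. 1.1.3 (arXiv p. 7 L57, p. 5 L93–99)] -/
theorem mem_span_pi_pow_smul_top_iff_coord (S : DVRSetting p K R N Rk Nbar Nq) {k : ℕ} {ι : Type*}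
    (b : Module.Basis ι (Rk k) (N k)) (j : ℕ) (x : N k) :
    x ∈ Ideal.span {S.π ^ j} • (⊤ : Submodule R (N k)) ↔
      ∀ i, b.coord i x ∈ Ideal.span {algebraMap R (Rk k) S.π ^ j} := by
  rw [S.mem_span_pi_pow_smul_top_iff, mem_smul_top_iff_forall_coord]

/-- A scalar of `R` whose image in `R_k` lies in `(π̄^j)` reduces to `0` in `R/π^j` (`j ≤ e_k`).
[cite: Howard2004HeegnerKolyvagin, §1.6 (arXiv p. 11, L33–34)] -/
theorem mk_eq_zero_of_algebraMap_mem (S : DVRSetting p K R N Rk Nbar Nq) (hy : S.SatisfiesH) {j k : ℕ}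
    (h : j ≤ S.e k) {r : R} (hr : algebraMap R (Rk k) r ∈ Ideal.span {algebraMap R (Rk k) S.π ^ j}) :
    (Ideal.Quotient.mk (Ideal.span {S.π ^ j}) r) = 0 := by
  rw [← S.ker_toQuotRing hy h, RingHom.mem_ker, toQuotRing_algebraMap] at hr
  exact hr

/-- **An `R/π^j`-basis of `T^{(k)}/π^j T^{(k)}`**: the classes of an `R_k`-basis of `T^{(k)}` (`j ≤ e_k`).
[cite: Howard2004HeegnerKolyvagin, H.0 with Rem. 1.3.1 (arXiv p. 7 L57, L125–127)] -/
theorem linearIndependent_mkQ_basis (S : DVRSetting p K R N Rk Nbar Nq) (hy : S.SatisfiesH) {j k : ℕ}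
    (h : j ≤ S.e k) {ι : Type*} (b : Module.Basis ι (Rk k) (N k)) :
    LinearIndependent (S.QuotRing j)
      (fun i => (Ideal.span {S.π ^ j} • (⊤ : Submodule R (N k))).mkQ (b i)) := by
  classical
  rw [linearIndependent_iff']
  intro s g hg i hi
  -- lift the coefficients to `R`
  choose c hc using fun i => Ideal.Quotient.mk_surjective (g i)
  have hsum : (Ideal.span {S.π ^ j} • (⊤ : Submodule R (N k))).mkQ (∑ i ∈ s, c i • b i) = 0 := by
    rw [map_sum]
    refine (Finset.sum_congr rfl fun i _ => ?_).trans hg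
    rw [map_smul, ← hc i]
    rfl
  rw [Submodule.mkQ_apply, Submodule.Quotient.mk_eq_zero, S.mem_span_pi_pow_smul_top_iff_coord b] at hsum
  have hci := hsum i
  simp only [map_sum, ← algebraMap_smul (Rk k) (c _), map_smul, Module.Basis.coord_apply,
    Module.Basis.repr_self, smul_eq_mul, Finsupp.single_apply, Finset.sum_ite_eq', mul_ite, mul_one,
    mul_zero] at hci
  rw [if_pos hi] at hci
  rw [← hc i]
  exact S.mk_eq_zero_of_algebraMap_mem hy h hci

/-- The classes of an `R_k`-basis span `T^{(k)}/π^j T^{(k)}` over `R/π^j`. [cite: Howard2004HeegnerKolyvagin, H.0 with Rem. 1.3.1 (arXiv p. 7 L57, L125–127)] -/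
theorem span_mkQ_basis_eq_top (S : DVRSetting p K R N Rk Nbar Nq) (hy : S.SatisfiesH) (j k : ℕ)
    {ι : Type*} (b : Module.Basis ι (Rk k) (N k)) :
    Submodule.span (S.QuotRing j)
      (Set.range fun i => (Ideal.span {S.π ^ j} • (⊤ : Submodule R (N k))).mkQ (b i)) = ⊤ := by
  classical
  rw [eq_top_iff]
  rintro x -
  obtain ⟨y, rfl⟩ := Submodule.mkQ_surjective _ x
  rw [← b.linearCombination_repr y, Finsupp.linearCombination_apply, map_finsuppSum]
  refine Submodule.finsuppSum_mem _ _ _ _ fun i _ => ?_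
  obtain ⟨r, hr⟩ := hy.algebraMap_surjective k (b.repr y i)
  rw [← hr, algebraMap_smul, map_smul, ← algebraMap_smul (S.QuotRing j) r]
  exact Submodule.smul_mem _ _ (Submodule.subset_span ⟨i, rfl⟩)

/-- **The `R/π^j`-basis of `T^{(k)}/π^j T^{(k)}`** induced by an `R_k`-basis of `T^{(k)}` (`j ≤ e_k`).
[cite: Howard2004HeegnerKolyvagin, H.0 with Rem. 1.3.1 (arXiv p. 7 L57, L125–127)] -/
def basisQuotLevel (S : DVRSetting p K R N Rk Nbar Nq) (hy : S.SatisfiesH) {j k : ℕ} (h : j ≤ S.e k)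
    {ι : Type*} (b : Module.Basis ι (Rk k) (N k)) :
    Module.Basis ι (S.QuotRing j) (N k ⧸ Ideal.span {S.π ^ j} • (⊤ : Submodule R (N k))) :=
  Module.Basis.mk (S.linearIndependent_mkQ_basis hy h b) (S.span_mkQ_basis_eq_top hy j k b).ge

/-- The basis vectors are the classes of the given basis. [cite: Howard2004HeegnerKolyvagin, H.0 (arXiv p. 7, L57)] -/
@[simp] theorem basisQuotLevel_apply (S : DVRSetting p K R N Rk Nbar Nq) (hy : S.SatisfiesH) {j k : ℕ}
    (h : j ≤ S.e k) {ι : Type*} (b : Module.Basis ι (Rk k) (N k)) (i : ι) :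
    S.basisQuotLevel hy h b i = (Ideal.span {S.π ^ j} • (⊤ : Submodule R (N k))).mkQ (b i) :=
  Module.Basis.mk_apply _ _ i

/-- **H.0 on the refined levels**: `T^{(k)}/π^j T^{(k)}` is free of rank two over `R/π^j` (`1 ≤ j ≤ e_k`; H.0 for
`T^{(k)}` over `R_k`).  With `k = host j` this is `H0 (S.QuotRing j) (D.Level j)` for the refinement datum `D`.
[cite: Howard2004HeegnerKolyvagin, H.0 with Rem. 1.3.1 (arXiv p. 7 L57, L125–127)] -/
theorem h0_quotLevel (S : DVRSetting p K R N Rk Nbar Nq) (hy : S.SatisfiesH) {j k : ℕ} (hj : 1 ≤ j)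
    (h : j ≤ S.e k) : H0 (S.QuotRing j) (N k ⧸ Ideal.span {S.π ^ j} • (⊤ : Submodule R (N k))) := by
  haveI := (hy.h0 k).1
  haveI : Module.Finite (Rk k) (N k) := Module.finite_of_finrank_eq_succ (hy.h0 k).2
  haveI := S.nontrivial_quotRing hy hj
  let b := Module.finBasisOfFinrankEq (Rk k) (N k) (hy.h0 k).2
  exact ⟨Module.Free.of_basis (S.basisQuotLevel hy h b), by
    rw [Module.finrank_eq_card_basis (S.basisQuotLevel hy h b), Fintype.card_fin]⟩

end DVRSetting

end Literature.NumberTheory.GaloisCohomology.Howard2004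

end
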